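import Summits.AtomisticToContinuum.BoseEinsteinCondensation.Theorems.BECRichardsonGaudinRichardsonAnchorBECPenalisedLowerBound
import Summits.AtomisticToContinuum.BoseEinsteinCondensation.Theorems.BECRichardsonGaudinRichardsonAnchorBECBornDefs
import Summits.AtomisticToContinuum.BoseEinsteinCondensation.Theorems.BECGroundStateSOSPeriodicIRBoundFsumCouplingSelect
import Literature.MathematicalPhysics.QuantumManyBody.TorusFockSectorDictionary
import Literature.MathematicalPhysics.QuantumManyBody.TorusFockLayer
import Summits.AtomisticToContinuum.BoseEinsteinCondensation.Theorems.BECRichardsonGaudinRichardsonAnchorBECModeAnSectorWave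
import Summits.AtomisticToContinuum.BoseEinsteinCondensation.Theorems.BECRichardsonGaudinRichardsonAnchorBECBornPolyNorms
import Summits.AtomisticToContinuum.BoseEinsteinCondensation.Theorems.BECRichardsonGaudinRichardsonAnchorBECBornPolyKinetic
import Summits.AtomisticToContinuum.BoseEinsteinCondensation.Theorems.BECRichardsonGaudinRichardsonAnchorBECBornPolyPairAux
import Summits.AtomisticToContinuum.BoseEinsteinCondensation.Theorems.BECRichardsonGaudinRichardsonAnchorBECEsymmRatioBounds
import Summits.AtomisticToContinuum.BoseEinsteinCondensation.Theorems.BECRichardsonGaudinRichardsonAnchorBECWindowLattice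
import Summits.AtomisticToContinuum.BoseEinsteinCondensation.Theorems.BECRichardsonGaudinRichardsonAnchorBECBornPolyPair
import HarnessLib

/-!
# Skeleton v4 (lead) — crux `RichardsonAnchorBEC` (stmt-AtomisticToContinuum-14805), route `BECRichardsonGaudin`,
# line `registered`

The crux, BY NAME: `Summit.AtomisticToContinuum.BoseEinsteinCondensation.Theses.BECRichardsonGaudin.RichardsonAnchorBEC`.

## State of the line

* LOWER BOUND — DONE, in the tree: `stub_penalisedLowerBound` (Theorems/…PenalisedLowerBound.lean, from the landed
  sums of squares `stub_pairSquareLower`, `stub_crossTermLower`, `stub_bandKineticLower`, `stub_condensatePairJensen`,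
  `stub_bandBubbleLower` and the core `stub_lowerBoundCore`); vocabulary `anchorE`, `bandBubble`, `bornEnergy`,
  `RichardsonAnchorBEC_iff` in Theorems/…Defs.lean.
* UPPER BOUND `Goal.stub_bornTrialState` (stub U) — reshaped here into six registered stubs + one assembly stub, following
  the lead's blueprint (NOTES.md `## U blueprint`): the trial state is the sector trial state of the number-conserving,
  pair-number-windowed, infrared-cut pair polynomial `bornTrialPoly` (Theorems/…BornDefs.lean):
  - `stub_modeAnSectorWave` (U0): `a(φ_{e p})Ψ_A = √(L³) Ψ_{∂_pA}`, `a(φ_m)Ψ_A = 0` off the modes;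
  - `stub_bornPolyNorms` (U2a), `stub_bornPolyKinetic` (U2b), `stub_bornPolyPair` (U2c): the Fock sums of `A`
    (norm, `‖∂₀A‖²`, kinetic sum, `‖QA‖²` with the interference factor `(1−β) + 2c·w(T)`);
  - `stub_esymmRatioBounds` (U3): elementary-symmetric-function inequalities and size-biased ratio bounds;
  - `stub_windowLattice` (U4): cube-shell lattice bookkeeping of the infrared window;
  - `stub_bornAssembly` (U-asm): U0 → U2a → U2b → U2c → U3 → U4 → `Goal.stub_bornTrialState` (the dictionary
    `E_κ(Ψ_A) = [Σ_p(ε_p+κ[p≠0])‖∂_pA‖² + (γ/2L³)‖QA‖²]/‖A‖²` from U0 + the landed pair-functional dictionary, and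
    the ε-bookkeeping `r, T₁, J₁, ρ₀, N₀` of the blueprint).
* Glue (sorry-free): `free_case`, `interacting_case`, `RichardsonAnchorBEC_of`, `RichardsonAnchorBEC_proof`.
-/

noncomputable section

namespace Summit.AtomisticToContinuum.BoseEinsteinCondensation.Cruxes.RichardsonAnchorBEC.Birth

open MeasureTheory Filter
open scoped ENNReal NNReal
open Literature.MathematicalPhysics.QuantumManyBody.BoseGas
open Summit.AtomisticToContinuum.BoseEinsteinCondensation.Theses.BECRichardsonGaudin
open Summit.AtomisticToContinuum.BoseEinsteinCondensation.Cruxes.PeriodicIRBound.LinearPhFloorWagner.WF (normSq innerRe)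

/-! ## Registered stubs of the upper bound (wave 2) -/

/- stub_modeAnSectorWave: LANDED in the tree (imported above). -/

/- stub_bornPolyNorms: LANDED in the tree (imported above). -/

/- stub_bornPolyKinetic: LANDED in the tree (imported above). -/

/- stub_bornPolyPair: LANDED in the tree (imported above). -/

/- stub_esymmRatioBounds: LANDED in the tree (imported above). -/

/- stub_windowLattice: LANDED in the tree (imported above). -/

/-! ## Registered stubs of the upper bound (wave 3) -/

/-- **stub U1 — the anchor functional of a sector trial state over the band modes.** For a non-zero homogeneous
polynomial `A` of degree `N = n+2` over `ι = ↥(momentumBand M)`, `M = ⌊ΛL/2π⌋`, `L = L_N(ρ)`, and `γ, κ ≥ 0`: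
`E_κ(Ψ_A/‖Ψ_A‖) ≤ [Σ_p (|k_p|² + κ[p ≠ 0]) ‖∂_pA‖² + (γ/2L³) ‖QA‖²] / ‖A‖²`, `Q = Σ_{p} ∂_{−p}∂_p` (in fact equality):
kinetic part `lintegral_kineticDensity_sectorTrialState`; `n₀ = ‖a₀Ψ‖² = ‖∂₀A‖²/‖A‖²` and
`‖Σ_{k∈B}a_{−k}a_kΨ‖² = ‖QA‖²/‖A‖²` by the landed dictionary `stub_modeAnSectorWave` (`a(φ_{e p})Ψ_A = √(L³)Ψ_{∂_pA}`)
with `integral_cellN_norm_sq_sectorWave`, Euler `sum_fockInner_pderiv_pderiv` for `N − n₀`, and the landed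
pair-functional conversion `stub_bandKineticLower` (c). Size M–L. [folklore] -/
theorem stub_anchorESector :
    ∀ (γ κ ρ Λ : ℝ) (n M : ℕ) (hρ : 0 < ρ) (A : MvPolynomial ↥(momentumBand M) ℂ)
      (hA : A.IsHomogeneous (n + 2)) (hA0 : A ≠ 0),
      0 ≤ γ → 0 ≤ κ → M = ⌊Λ * sideLength ρ (n + 2) / (2 * Real.pi)⌋₊ →
      anchorE γ κ ρ n Λ (sectorTrialState (sideLength_succ_succ_pos hρ n) Subtype.val_injective hA hA0) ≤
        ENNReal.ofReal
          (((∑ p : ↥(momentumBand M),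
              (‖waveVector (sideLength ρ (n + 2)) p.1‖ ^ 2 + if p.1 = 0 then 0 else κ) *
                (Fock.fockInner (MvPolynomial.pderiv p A) (MvPolynomial.pderiv p A)).re) +
            γ / (2 * sideLength ρ (n + 2) ^ 3) *
              (Fock.fockInner
                (∑ p : ↥(momentumBand M), MvPolynomial.pderiv (-p) (MvPolynomial.pderiv p A))
                (∑ p : ↥(momentumBand M), MvPolynomial.pderiv (-p) (MvPolynomial.pderiv p A))).re) /
          (Fock.fockInner A A).re) := by
  sorry

/-! ### Audit names of the stub statements (verbatim) -/

namespace Goal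

/-- The Born upper bound (stub U of the birth skeleton; now the conclusion of `stub_bornAssembly`). -/
abbrev stub_bornTrialState : Prop :=
    ∀ γ Λ ε : ℝ, 0 < γ → 0 < Λ → 0 < ε → ∃ ρ₀ : ℝ, 0 < ρ₀ ∧ ∀ ρ : ℝ, 0 < ρ → ρ < ρ₀ →
      ∀ᶠ n : ℕ in Filter.atTop,
        (⨅ Φ, anchorE γ (2 * ρ * γ) ρ n Λ Φ) ≤
          ENNReal.ofReal (bornEnergy γ ρ n Λ) + ENNReal.ofReal (ε * (ρ * γ) * ((n + 2 : ℕ) : ℝ))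

/-- Statement of stub U0 `stub_modeAnSectorWave`. -/
abbrev stub_modeAnSectorWave : Prop :=
    ∀ {ι : Type} [Fintype ι] [DecidableEq ι] (L : ℝ) (e : ι → Momentum) (A : MvPolynomial ι ℂ) (n : ℕ),
      0 < L → Function.Injective e →
      (∀ p : ι, modeAn L (planeWaveMode L (e p)) (sectorWave L e A (n + 1)) =
          fun Y => ((Real.sqrt (L ^ 3) : ℝ) : ℂ) * sectorWave L e (MvPolynomial.pderiv p A) n Y) ∧
      (∀ m : Momentum, m ∉ Set.range e →
          modeAn L (planeWaveMode L m) (sectorWave L e A (n + 1)) = fun _ => 0)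

/-- Statement of stub U2a `stub_bornPolyNorms`. -/
abbrev stub_bornPolyNorms : Prop :=
    ∀ (γ L : ℝ) (M R N J₁ : ℕ), 0 < L → 2 * J₁ + 2 ≤ N →
      (bornTrialPoly γ L M R N J₁).IsHomogeneous N ∧ bornTrialPoly γ L M R N J₁ ≠ 0 ∧
      (Fock.fockInner (bornTrialPoly γ L M R N J₁) (bornTrialPoly γ L M R N J₁)).re =
        ∑ j ∈ Finset.range (J₁ + 1),
          bornCoeff γ L M R N j ^ 2 * ((N - 2 * j).factorial : ℝ) * pairEsymm L M R j ∧
      (Fock.fockInner (MvPolynomial.pderiv (toBand M 0) (bornTrialPoly γ L M R N J₁))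
          (MvPolynomial.pderiv (toBand M 0) (bornTrialPoly γ L M R N J₁))).re =
        ∑ j ∈ Finset.range (J₁ + 1),
          bornCoeff γ L M R N j ^ 2 * ((N - 2 * j).factorial : ℝ) * ((N : ℝ) - 2 * j) * pairEsymm L M R j ∧
      (∀ f : Momentum → ℝ, ∑ m ∈ pairWindow M R, f m = ∑ m ∈ pairReps M R, (f m + f (-m))) ∧
      (∀ m ∈ pairReps M R, m ≠ 0 ∧ -m ∈ pairWindow M R ∧ -m ∉ pairReps M R)

/-- Statement of stub U2b `stub_bornPolyKinetic`. -/
abbrev stub_bornPolyKinetic : Prop :=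
    ∀ (γ L : ℝ) (M R N J₁ : ℕ), 0 < L → 2 * J₁ + 2 ≤ N →
      ∑ p : ↥(momentumBand M), ‖waveVector L p.1‖ ^ 2 *
          (Fock.fockInner (MvPolynomial.pderiv p (bornTrialPoly γ L M R N J₁))
            (MvPolynomial.pderiv p (bornTrialPoly γ L M R N J₁))).re ≤
        ∑ j ∈ Finset.Ico 1 (J₁ + 1), bornCoeff γ L M R N j ^ 2 * ((N - 2 * j).factorial : ℝ) *
          (2 * ∑ m ∈ pairReps M R, modeWeight L m) * pairEsymm L M R (j - 1)

/-- Statement of stub U2c `stub_bornPolyPair`. -/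
abbrev stub_bornPolyPair : Prop :=
    ∀ (γ L Θ : ℝ) (M R N J₁ : ℕ), 0 < L → 0 ≤ γ → 0 ≤ Θ → 2 * J₁ + 2 ≤ N →
      (∀ m ∈ pairReps M R, modeWeight L m ≤ Θ) →
      2 * bornCoupling γ L M R * ∑ m ∈ pairReps M R, modeWeight L m ≤ 1 →
      (Fock.fockInner
          (∑ p : ↥(momentumBand M), MvPolynomial.pderiv (-p) (MvPolynomial.pderiv p (bornTrialPoly γ L M R N J₁)))
          (∑ p : ↥(momentumBand M), MvPolynomial.pderiv (-p) (MvPolynomial.pderiv p (bornTrialPoly γ L M R N J₁)))).re ≤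
        (1 - 2 * bornCoupling γ L M R * ∑ m ∈ pairReps M R, modeWeight L m +
            2 * bornCoupling γ L M R * J₁ * Θ) ^ 2 *
          ∑ j ∈ Finset.range J₁, bornCoeff γ L M R N j ^ 2 * ((N - 2 * j).factorial : ℝ) *
            (((N : ℝ) - 2 * j) * ((N : ℝ) - 2 * j - 1)) * pairEsymm L M R j +
        bornCoeff γ L M R N J₁ ^ 2 * ((N - 2 * J₁).factorial : ℝ) *
          (((N : ℝ) - 2 * J₁) * ((N : ℝ) - 2 * J₁ - 1)) * pairEsymm L M R J₁

/-- Statement of stub U3 `stub_esymmRatioBounds`. -/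
abbrev stub_esymmRatioBounds : Prop :=
    (∀ {α : Type} [DecidableEq α] (s : Finset α) (x : α → ℝ), (∀ a ∈ s, 0 ≤ x a) → ∀ j : ℕ,
      ((j : ℝ) + 1) * (∑ t ∈ s.powersetCard (j + 1), ∏ a ∈ t, x a) ≤
          (∑ a ∈ s, x a) * ∑ t ∈ s.powersetCard j, ∏ a ∈ t, x a ∧
      (∀ X : ℝ, (∀ a ∈ s, x a ≤ X) →
        (∑ a ∈ s, x a) * (∑ t ∈ s.powersetCard j, ∏ a ∈ t, x a) ≤
          ((j : ℝ) + 1) * (∑ t ∈ s.powersetCard (j + 1), ∏ a ∈ t, x a) +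
            j * X * ∑ t ∈ s.powersetCard j, ∏ a ∈ t, x a) ∧
      (∀ (w : α → ℝ) (Wm : ℝ), (∀ a ∈ s, 0 ≤ w a ∧ w a ≤ Wm) →
        (∑ t ∈ s.powersetCard j, (∏ a ∈ t, x a) * ∑ a ∈ t, w a) ≤
            j * Wm * ∑ t ∈ s.powersetCard j, ∏ a ∈ t, x a ∧
        (∑ t ∈ s.powersetCard j, (∏ a ∈ t, x a) * (∑ a ∈ t, w a) ^ 2) ≤
            (j * Wm) ^ 2 * ∑ t ∈ s.powersetCard j, ∏ a ∈ t, x a) ∧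
      (∀ a ∈ s, (∑ t ∈ (s.erase a).powersetCard j, ∏ b ∈ t, x b) ≤ ∑ t ∈ s.powersetCard j, ∏ b ∈ t, x b)) ∧
    (∀ (W : ℕ → ℝ) (m : ℝ) (J : ℕ), (∀ j, 0 ≤ W j) → 0 ≤ m →
      (∀ j, j < J → ((j : ℝ) + 1) * W (j + 1) ≤ m * W j) →
      (∑ j ∈ Finset.range (J + 1), (j : ℝ) * W j ≤ m * ∑ j ∈ Finset.range (J + 1), W j) ∧
      (∀ j₀ : ℕ, j₀ ≤ J → 2 * m ≤ (j₀ : ℝ) →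
        W J ≤ (1 / 2) ^ (J - j₀) * ∑ j ∈ Finset.range (J + 1), W j))

/-- Statement of stub U4 `stub_windowLattice`. -/
abbrev stub_windowLattice : Prop :=
    ∀ (L : ℝ) (R M : ℕ), 0 < L →
      1 / (2 * L ^ 3) * ∑ m ∈ (momentumBand R).erase 0, 1 / ‖waveVector L m‖ ^ 2 ≤
          13 * R / (4 * Real.pi ^ 2 * L) ∧
      (∀ m : Momentum, m ∉ momentumBand R → 4 * Real.pi ^ 2 * ((R : ℝ) + 1) ^ 2 / L ^ 2 ≤ ‖waveVector L m‖ ^ 2) ∧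
      ∑ m ∈ momentumBand M \ momentumBand R, 1 / ‖waveVector L m‖ ^ 4 ≤
          13 * L ^ 4 / (4 * Real.pi ^ 4 * ((R : ℝ) + 1)) ∧
      (2 * R + 1 ≤ M →
        L ^ 4 / (24 * Real.pi ^ 4 * ((R : ℝ) + 1)) ≤
          ∑ m ∈ momentumBand M \ momentumBand R, 1 / ‖waveVector L m‖ ^ 4)

/-- The condensate-penalised lower bound (landed: `stub_penalisedLowerBound` of Theorems/…PenalisedLowerBound.lean). -/
abbrev stub_penalisedLowerBound : Prop :=
    ∀ γ Λ : ℝ, 0 < γ → 0 < Λ → ∃ ϑ : ℝ, 0 < ϑ ∧ ∀ ε : ℝ, 0 < ε → ∃ ρ₀ : ℝ, 0 < ρ₀ ∧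
      ∀ ρ : ℝ, 0 < ρ → ρ < ρ₀ → ∀ᶠ n : ℕ in Filter.atTop,
        ∀ Φ : PeriodicTrialState (n + 2) (sideLength ρ (n + 2)),
          ENNReal.ofReal (bornEnergy γ ρ n Λ + ϑ * (ρ * γ) * (1 - ε) * ((n + 2 : ℕ) : ℝ)) ≤
            anchorE γ (2 * ρ * γ) ρ n Λ Φ +
              ENNReal.ofReal (ϑ * (ρ * γ)) * condensateOccupation (n + 2) (sideLength ρ (n + 2)) Φ.ψ

/-- Statement of stub U1 `stub_anchorESector`. -/
abbrev stub_anchorESector : Prop :=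
    ∀ (γ κ ρ Λ : ℝ) (n M : ℕ) (hρ : 0 < ρ) (A : MvPolynomial ↥(momentumBand M) ℂ)
      (hA : A.IsHomogeneous (n + 2)) (hA0 : A ≠ 0),
      0 ≤ γ → 0 ≤ κ → M = ⌊Λ * sideLength ρ (n + 2) / (2 * Real.pi)⌋₊ →
      anchorE γ κ ρ n Λ (sectorTrialState (sideLength_succ_succ_pos hρ n) Subtype.val_injective hA hA0) ≤
        ENNReal.ofReal
          (((∑ p : ↥(momentumBand M),
              (‖waveVector (sideLength ρ (n + 2)) p.1‖ ^ 2 + if p.1 = 0 then 0 else κ) *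
                (Fock.fockInner (MvPolynomial.pderiv p A) (MvPolynomial.pderiv p A)).re) +
            γ / (2 * sideLength ρ (n + 2) ^ 3) *
              (Fock.fockInner
                (∑ p : ↥(momentumBand M), MvPolynomial.pderiv (-p) (MvPolynomial.pderiv p A))
                (∑ p : ↥(momentumBand M), MvPolynomial.pderiv (-p) (MvPolynomial.pderiv p A))).re) /
          (Fock.fockInner A A).re)

/-- **The Born bound at fixed parameters** (conclusion of `stub_bornFixedBound`, hypothesis of `stub_bornEventually`):
with `N = n+2`, `L = L_N(ρ)`, `M = ⌊ΛL/2π⌋`, `W₊ = pairReps M R`, `θ = modeWeight L`, `σ = Σ_{W₊}θ`, `p = Σ_{W₊}θ²`,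
`c = bornCoupling`, `m = c²N²p`, any `Θ ≥ θ` on `W₊`, `u = J₁Θ²/p ≤ 1/2`, `δ = 2cJ₁Θ`, `2m ≤ J₁ − T₁`:
`inf E_Δ ≤ γρN/(2(1+γJ_W)) + (γρN/2)(u/2 + 2δ + δ² + 2^{−T₁}) + 4γρm`. -/
abbrev bornFixedBound : Prop :=
    ∀ (γ ρ Λ Θ : ℝ) (n R J₁ T₁ : ℕ), 0 < γ → 0 < ρ → 0 ≤ Θ →
      2 * J₁ + 2 ≤ n + 2 → T₁ ≤ J₁ →
      2 * (bornCoupling γ (sideLength ρ (n + 2)) ⌊Λ * sideLength ρ (n + 2) / (2 * Real.pi)⌋₊ R ^ 2 *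
          ((n + 2 : ℕ) : ℝ) ^ 2 *
          ∑ m ∈ pairReps ⌊Λ * sideLength ρ (n + 2) / (2 * Real.pi)⌋₊ R, modeWeight (sideLength ρ (n + 2)) m ^ 2) ≤
        ((J₁ - T₁ : ℕ) : ℝ) →
      0 < ∑ m ∈ pairReps ⌊Λ * sideLength ρ (n + 2) / (2 * Real.pi)⌋₊ R, modeWeight (sideLength ρ (n + 2)) m ^ 2 →
      (J₁ : ℝ) * Θ ^ 2 /
          (∑ m ∈ pairReps ⌊Λ * sideLength ρ (n + 2) / (2 * Real.pi)⌋₊ R, modeWeight (sideLength ρ (n + 2)) m ^ 2) ≤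
        1 / 2 →
      (∀ m ∈ pairReps ⌊Λ * sideLength ρ (n + 2) / (2 * Real.pi)⌋₊ R, modeWeight (sideLength ρ (n + 2)) m ≤ Θ) →
      (⨅ Φ, anchorE γ (2 * ρ * γ) ρ n Λ Φ) ≤
        ENNReal.ofReal
          (γ * ρ * ((n + 2 : ℕ) : ℝ) /
              (2 * (1 + γ * windowBubble (sideLength ρ (n + 2)) ⌊Λ * sideLength ρ (n + 2) / (2 * Real.pi)⌋₊ R)) +
            γ * ρ * ((n + 2 : ℕ) : ℝ) / 2 *
              ((J₁ : ℝ) * Θ ^ 2 /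
                    (∑ m ∈ pairReps ⌊Λ * sideLength ρ (n + 2) / (2 * Real.pi)⌋₊ R,
                      modeWeight (sideLength ρ (n + 2)) m ^ 2) / 2 +
                2 * (2 * bornCoupling γ (sideLength ρ (n + 2)) ⌊Λ * sideLength ρ (n + 2) / (2 * Real.pi)⌋₊ R * J₁ * Θ) +
                (2 * bornCoupling γ (sideLength ρ (n + 2)) ⌊Λ * sideLength ρ (n + 2) / (2 * Real.pi)⌋₊ R * J₁ * Θ) ^ 2 +
                (1 / 2 : ℝ) ^ T₁) +
            4 * γ * ρ *
              (bornCoupling γ (sideLength ρ (n + 2)) ⌊Λ * sideLength ρ (n + 2) / (2 * Real.pi)⌋₊ R ^ 2 *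
                ((n + 2 : ℕ) : ℝ) ^ 2 *
                ∑ m ∈ pairReps ⌊Λ * sideLength ρ (n + 2) / (2 * Real.pi)⌋₊ R, modeWeight (sideLength ρ (n + 2)) m ^ 2))

/-- Statement of stub U6a `stub_bornFixedBound`. -/
abbrev stub_bornFixedBound : Prop :=
    stub_anchorESector → bornFixedBound

/-- Statement of stub U6b `stub_bornEventually`. -/
abbrev stub_bornEventually : Prop :=
    bornFixedBound → stub_bornTrialState

end Goal

/-! ### The two assembly stubs of the upper bound -/

/-- **stub U6a — the Born bound at fixed parameters** from U1 and the landed U2a (`stub_bornPolyNorms`), U2b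
(`stub_bornPolyKinetic`), U2c (`stub_bornPolyPair`), U3 (`stub_esymmRatioBounds`): take `A = bornTrialPoly γ L M R N J₁`;
`E(Ψ_A)·‖A‖² ≤ Σ_p ε_p‖∂_pA‖² + Δ(N‖A‖² − ‖∂₀A‖²) + (g/2)‖QA‖²` (U1 + Euler), `W_j := λ_j²(N−2j)! e_j`, `Z = Σ W_j`,
`(j+1)W_{j+1} ≤ m W_j` (U3.a), so `Σ jW_j ≤ mZ`, `W_{J₁} ≤ 2^{−T₁}Z` (U3 block 2); kinetic `≤ 2σc²N²Z/(1−u)` (U2b + U3.b),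
`N_ex ≤ 2m` (U2a), pair `≤ (g/2)N²Z[(1−β+δ)² + 2^{−T₁}]` (U2c), `σ = L³J_W` (U2a window symmetry), `β = 2cσ = γJ_W/(1+γJ_W)`,
`2σc²N² = (γρN/2)γJ_W/(1+γJ_W)²`, `1/(1−u) ≤ 1 + 2u`. Size L. [folklore] -/
theorem stub_bornFixedBound :
    Goal.stub_anchorESector → Goal.bornFixedBound := by
  sorry

/-- **stub U6b — the eventual bookkeeping of the Born bound**: given `γ, Λ, ε > 0` choose
`r = min(Λ/(8π), 8π²ε/(65γ))`, `T₁` with `2^{−T₁} ≤ 2ε/5`, `R = ⌊rL⌋`, `J₁ = ⌈2m⌉ + T₁`, `Θ = L²/(4π²(R+1)²)`, and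
`ρ₀(γ,Λ,ε)`, `N₀` such that the landed lattice bounds `stub_windowLattice` give `γ(J_M − J_W) ≤ 2ε/5`, `u/2 ≤ 2ε/5`,
`2δ + δ² ≤ 2ε/5`, `4m/N ≤ ε/5` and the side conditions of `bornFixedBound` (`2J₁+2 ≤ N`, `p > 0`, `u ≤ 1/2`, `2R+1 ≤ M`);
then `inf E_Δ ≤ bornEnergy + εργN`. Size L. [folklore] -/
theorem stub_bornEventually :
    Goal.bornFixedBound → Goal.stub_bornTrialState := by
  sorry

/-! ## Proved glue (no `sorry` below this line) -/

/-- **Base case `γ = 0` (the free torus gas), PROVED from the tree**: `inf E = E₀^per(0) = 0`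
(`periodicGroundStateEnergy_zero_eq_zero`) and the kinetic gap `N ≤ n₀(Ψ) + (L/2π)² E(Ψ)`
(`CouplingSelect.natCast_le_condensateOccupation_add_energy`, packaged as `CouplingSelect.anchor`):
with `δ = 4π²εN/L²` every `δ`-near-minimiser has `n₀ ≥ (1-ε)N`. [folklore] -/
theorem free_case (Λ ε : ℝ) (hε : 0 < ε) :
    ∃ ρ₀ : ℝ, 0 < ρ₀ ∧ ∀ ρ : ℝ, 0 < ρ → ρ < ρ₀ → ∀ᶠ n : ℕ in Filter.atTop, ∃ δ : ℝ≥0∞, 0 < δ ∧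
      ∀ Ψ : PeriodicTrialState (n + 2) (sideLength ρ (n + 2)),
        anchorE 0 (2 * ρ * 0) ρ n Λ Ψ ≤ (⨅ Φ, anchorE 0 (2 * ρ * 0) ρ n Λ Φ) + δ →
          ENNReal.ofReal ((1 - ε) * ((n + 2 : ℕ) : ℝ)) ≤
            condensateOccupation (n + 2) (sideLength ρ (n + 2)) Ψ.ψ := by
  refine ⟨1, one_pos, fun ρ hρ _ => Filter.Eventually.of_forall fun n => ?_⟩
  have hL : 0 < sideLength ρ (n + 2) := sideLength_succ_succ_pos hρ n
  obtain ⟨δ, hδ, h⟩ :=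
    Summit.AtomisticToContinuum.BoseEinsteinCondensation.Cruxes.PeriodicIRBound.FsumPhasePencil.CouplingSelect.anchor
      (N := n + 2) (L := sideLength ρ (n + 2)) (by omega) hL (b := 1 - ε) (by linarith)
      (0 : ℝ → ℝ≥0∞) rfl
  refine ⟨δ, hδ, fun Ψ hΨ => ENNReal.ofReal_le_of_le_toReal (h Ψ ?_)⟩
  have hinf : (⨅ Φ, anchorE 0 (2 * ρ * 0) ρ n Λ Φ) =
      periodicGroundStateEnergy 0 (n + 2) (sideLength ρ (n + 2)) := by
    simp only [anchorE_zero]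
    rfl
  rw [← hinf, ← anchorE_zero ρ n Λ Ψ]
  exact hΨ

/-- **Interacting case `γ > 0` from the two stub STATEMENTS** (the variational / Hellmann–Feynman
inequality at fixed `N`, all in `ℝ≥0∞`): stub L at `(ε/3)` gives `ϑ` and, for every state,
`e_ref + λ(1-ε/3)N ≤ E_Δ(Ψ) + λ n₀(Ψ)` with `λ = ϑργ`; stub U at `εϑ/3` gives
`inf E_Δ ≤ e_ref + (εϑ/3)ργN`; for a `δ`-near-minimiser with `δ := (εϑ/3)ργN` the chain
`e_ref + λ(1-ε/3)N ≤ inf E_Δ + δ + λn₀ ≤ e_ref + 2δ + λn₀` cancels `e_ref` (finite) and leaves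
`λ(1-ε)N ≤ λ n₀`, i.e. `(1-ε)N ≤ n₀`. [folklore] -/
theorem interacting_case {γ Λ ε : ℝ} (hγ : 0 < γ) (hΛ : 0 < Λ) (hε : 0 < ε)
    (hU : Goal.stub_bornTrialState) (hL : Goal.stub_penalisedLowerBound) :
    ∃ ρ₀ : ℝ, 0 < ρ₀ ∧ ∀ ρ : ℝ, 0 < ρ → ρ < ρ₀ → ∀ᶠ n : ℕ in Filter.atTop, ∃ δ : ℝ≥0∞, 0 < δ ∧
      ∀ Ψ : PeriodicTrialState (n + 2) (sideLength ρ (n + 2)),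
        anchorE γ (2 * ρ * γ) ρ n Λ Ψ ≤ (⨅ Φ, anchorE γ (2 * ρ * γ) ρ n Λ Φ) + δ →
          ENNReal.ofReal ((1 - ε) * ((n + 2 : ℕ) : ℝ)) ≤
            condensateOccupation (n + 2) (sideLength ρ (n + 2)) Ψ.ψ := by
  -- `ε ≥ 1`: the conclusion is `0 ≤ n₀`
  rcases le_or_gt 1 ε with hε1 | hε1
  · refine ⟨1, one_pos, fun ρ hρ _ => Filter.Eventually.of_forall fun n => ⟨1, one_pos, fun Ψ _ => ?_⟩⟩
    rw [ENNReal.ofReal_of_nonpos (mul_nonpos_of_nonpos_of_nonneg (by linarith) (by positivity))]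
    exact bot_le
  -- `0 < ε < 1`
  obtain ⟨ϑ, hϑ, hL1⟩ := hL γ Λ hγ hΛ
  obtain ⟨ρ₁, hρ₁, h₁⟩ := hL1 (ε / 3) (by positivity)
  obtain ⟨ρ₂, hρ₂, h₂⟩ := hU γ Λ (ε * ϑ / 3) hγ hΛ (by positivity)
  refine ⟨min ρ₁ ρ₂, lt_min hρ₁ hρ₂, fun ρ hρ hρlt => ?_⟩
  filter_upwards [h₁ ρ hρ (hρlt.trans_le (min_le_left _ _)),
    h₂ ρ hρ (hρlt.trans_le (min_le_right _ _))] with n hLn hUn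
  set N : ℕ := n + 2 with hN
  set lam : ℝ := ϑ * (ρ * γ) with hlam
  set b : ℝ := bornEnergy γ ρ n Λ with hb
  set η : ℝ := ε * ϑ / 3 * (ρ * γ) * (N : ℝ) with hη
  have hlam0 : 0 < lam := by positivity
  have hNpos : (0 : ℝ) < N := by positivity
  have hb0 : 0 ≤ b := bornEnergy_nonneg hγ.le hρ n Λ
  have hη0 : 0 < η := by positivity
  have hA0 : 0 ≤ lam * (1 - ε / 3) * N := by
    have : 0 < 1 - ε / 3 := by linarith
    positivity
  refine ⟨ENNReal.ofReal η, ENNReal.ofReal_pos.2 hη0, fun Ψ hΨ => ?_⟩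
  set n₀ : ℝ≥0∞ := condensateOccupation N (sideLength ρ N) Ψ.ψ with hn₀
  have hLΨ := hLn Ψ
  have key : ENNReal.ofReal b + ENNReal.ofReal (lam * (1 - ε / 3) * N) ≤
      ENNReal.ofReal b + (ENNReal.ofReal η + ENNReal.ofReal η + ENNReal.ofReal lam * n₀) := by
    calc ENNReal.ofReal b + ENNReal.ofReal (lam * (1 - ε / 3) * N)
        = ENNReal.ofReal (b + lam * (1 - ε / 3) * N) := (ENNReal.ofReal_add hb0 hA0).symm
      _ ≤ anchorE γ (2 * ρ * γ) ρ n Λ Ψ + ENNReal.ofReal lam * n₀ := hLΨ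
      _ ≤ (⨅ Φ, anchorE γ (2 * ρ * γ) ρ n Λ Φ) + ENNReal.ofReal η + ENNReal.ofReal lam * n₀ :=
          add_le_add hΨ le_rfl
      _ ≤ ENNReal.ofReal b + ENNReal.ofReal η + ENNReal.ofReal η + ENNReal.ofReal lam * n₀ :=
          add_le_add (add_le_add hUn le_rfl) le_rfl
      _ = ENNReal.ofReal b + (ENNReal.ofReal η + ENNReal.ofReal η + ENNReal.ofReal lam * n₀) := by
          simp only [add_assoc]
  have key2 : ENNReal.ofReal (lam * (1 - ε / 3) * N) ≤
      ENNReal.ofReal η + ENNReal.ofReal η + ENNReal.ofReal lam * n₀ :=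
    (ENNReal.add_le_add_iff_left ENNReal.ofReal_ne_top).1 key
  have key3 : ENNReal.ofReal (lam * (1 - ε / 3) * N - (η + η)) ≤ ENNReal.ofReal lam * n₀ := by
    rw [ENNReal.ofReal_sub _ (by positivity), ENNReal.ofReal_add hη0.le hη0.le]
    exact tsub_le_iff_right.2 (key2.trans_eq (add_comm _ _))
  have hring : lam * (1 - ε / 3) * N - (η + η) = lam * ((1 - ε) * N) := by
    simp only [hlam, hη]
    ring
  rw [hring, ENNReal.ofReal_mul hlam0.le] at key3
  exact (ENNReal.mul_le_mul_iff_right (ENNReal.ofReal_pos.2 hlam0).ne' ENNReal.ofReal_ne_top).1 key3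

/-- **THE SKELETON THEOREM — the crux BY NAME from the open stub statements**: U1 (`stub_anchorESector`), U6a
(`stub_bornFixedBound`) and U6b (`stub_bornEventually`) give `Goal.stub_bornTrialState`; the lower bound
`stub_penalisedLowerBound` and the unfolding `RichardsonAnchorBEC_iff` are theorems of the tree; split `γ = 0`
(`free_case`) / `γ > 0` (`interacting_case`). [folklore] -/
theorem RichardsonAnchorBEC_of :
    Goal.stub_anchorESector → Goal.stub_bornFixedBound → Goal.stub_bornEventually →
      Summit.AtomisticToContinuum.BoseEinsteinCondensation.Theses.BECRichardsonGaudin.RichardsonAnchorBEC := by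
  intro h1 h6a h6b
  have hU : Goal.stub_bornTrialState := h6b (h6a h1)
  refine RichardsonAnchorBEC_iff.mpr ?_
  intro γ Λ ε hγ hΛ hε
  rcases hγ.eq_or_lt with h | hγ'
  · subst h
    exact free_case Λ ε hε
  · exact interacting_case hγ' hΛ hε hU stub_penalisedLowerBound

/-- The skeleton as a (sorried-through-the-stubs) proof of the crux. [folklore] -/
theorem RichardsonAnchorBEC_proof :
    Summit.AtomisticToContinuum.BoseEinsteinCondensation.Theses.BECRichardsonGaudin.RichardsonAnchorBEC :=
  RichardsonAnchorBEC_of stub_anchorESector stub_bornFixedBound stub_bornEventually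

end Summit.AtomisticToContinuum.BoseEinsteinCondensation.Cruxes.RichardsonAnchorBEC.Birth

end
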